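import Summits.AtomisticToContinuum.BoseEinsteinCondensation.Theses.BECThomsonPrinciple
import Summits.AtomisticToContinuum.BoseEinsteinCondensation.Theses.BECInsertionCorrector
import Summits.AtomisticToContinuum.BoseEinsteinCondensation.Theorems.StaticResponseBound.Negative.Basic
import Summits.AtomisticToContinuum.BoseEinsteinCondensation.Theorems.DensityResponse.Negative.StiffnessSwitch

/-!
# Nesting bridge: `StaticResponseBound` (stmt-12057) ⟹ `DensityResponse` (stmt-9481)

Planner sketch (crux-ideate round 2, ideator 4).  The sibling crux of route `BECInsertionCorrector`
is the same static-response chord WITHOUT the momentum window and with an `M`-uniform constant;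
it implies this crux with `C ↦ 8C`, `ρ₀ ↦ ρ₀/2`, `N₀ = 1`, for EVERY window parameter `M`.
-/

noncomputable section

open MeasureTheory
open scoped ENNReal BigOperators

namespace Summit.AtomisticToContinuum.BoseEinsteinCondensation.Cruxes.DensityResponse.Nesting

open Literature.MathematicalPhysics.QuantumManyBody.BoseGas

/-- `L_N(N/L³) = L`. [folklore] -/
theorem sideLength_div_pow_three_self {L : ℝ} (hL : 0 < L) {N : ℕ} (hN : 0 < N) :
    sideLength ((N : ℝ) / L ^ 3) N = L := by
  unfold sideLength
  have hN' : (0 : ℝ) < N := Nat.cast_pos.2 hN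
  have hL3 : 0 < L ^ 3 := pow_pos hL 3
  rw [div_div_eq_mul_div, mul_comm, mul_div_assoc, div_self hN'.ne', mul_one,
    show (1 / 3 : ℝ) = ((3 : ℕ) : ℝ)⁻¹ by norm_num, Real.pow_rpow_inv_natCast hL.le three_ne_zero]

/-- The Euclidean momentum square dominates the sup-norm momentum square:
`(2π‖n‖_∞/L)² ≤ (2π/L)² Σᵢ nᵢ²`. [folklore] -/
theorem kinf_sq_le_psq (L : ℝ) (n : Fin 3 → ℤ) :
    (2 * Real.pi * ‖(fun j => (n j : ℝ))‖ / L) ^ 2 ≤ (2 * Real.pi / L) ^ 2 * ∑ i, (n i : ℝ) ^ 2 := by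
  have hS : 0 ≤ ∑ i, (n i : ℝ) ^ 2 := Finset.sum_nonneg fun i _ => sq_nonneg _
  have hle : ‖(fun j => (n j : ℝ))‖ ≤ Real.sqrt (∑ i, (n i : ℝ) ^ 2) := by
    refine (pi_norm_le_iff_of_nonneg (Real.sqrt_nonneg _)).2 fun i => ?_
    rw [Real.norm_eq_abs, ← Real.sqrt_sq_eq_abs]
    exact Real.sqrt_le_sqrt (Finset.single_le_sum (f := fun i => (n i : ℝ) ^ 2)
      (fun i _ => sq_nonneg _) (Finset.mem_univ i))
  have hsum : ‖(fun j => (n j : ℝ))‖ ^ 2 ≤ ∑ i, (n i : ℝ) ^ 2 := by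
    calc ‖(fun j => (n j : ℝ))‖ ^ 2 ≤ (Real.sqrt (∑ i, (n i : ℝ) ^ 2)) ^ 2 :=
          pow_le_pow_left₀ (norm_nonneg _) hle 2
      _ = ∑ i, (n i : ℝ) ^ 2 := Real.sq_sqrt hS
  calc (2 * Real.pi * ‖(fun j => (n j : ℝ))‖ / L) ^ 2
      = (2 * Real.pi / L) ^ 2 * ‖(fun j => (n j : ℝ))‖ ^ 2 := by ring
    _ ≤ (2 * Real.pi / L) ^ 2 * ∑ i, (n i : ℝ) ^ 2 :=
        mul_le_mul_of_nonneg_left hsum (sq_nonneg _)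

/-- **Nesting bridge.** The sibling crux `BECInsertionCorrector.StaticResponseBound`
(stmt-AtomisticToContinuum-12057: all modes, `M`-uniform constant, signed coupling) implies
`BECThomsonPrinciple.DensityResponse` (stmt-AtomisticToContinuum-9481) for every window `M`,
with `ρ₀ ↦ ρ₀/2`, `C ↦ 8C`, `N₀ = 1`. -/
theorem densityResponse_of_staticResponseBound
    (hS : Theses.BECInsertionCorrector.StaticResponseBound) :
    Theses.BECThomsonPrinciple.DensityResponse := by
  intro v hv M _hM
  obtain ⟨ρ₀, hρ₀, C, hC, h⟩ := hS v hv
  refine ⟨ρ₀ / 2, 8 * C, by positivity, by positivity, 1, ?_⟩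
  intro N hN L hL hNL n hn _hwin s hs Φ
  -- trivial when the trial state has infinite energy
  by_cases hE : periodicEnergy v Φ = ⊤
  · simp [hE]
  -- the density of the datum and the side length
  set ρ : ℝ := (N : ℝ) / L ^ 3 with hρdef
  have hNpos : (0 : ℝ) < N := Nat.cast_pos.2 hN
  have hL3 : 0 < L ^ 3 := pow_pos hL 3
  have hρpos : 0 < ρ := div_pos hNpos hL3
  have hρlt : ρ < ρ₀ := by
    have : ρ ≤ ρ₀ / 2 := by
      rw [hρdef, div_le_iff₀ hL3]; exact hNL
    linarith
  have hL' : sideLength ρ N = L := sideLength_div_pow_three_self hL hN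
  -- the sibling statement at this datum, transported to side `L`
  have key := h ρ hρpos hρlt N n hn
  rw [hL'] at key
  -- the source integral and the sign of the coupling
  set I : ℝ := ∫ X in cellN N L, (∑ i, Real.cos (2 * Real.pi / L * ∑ j, (n j : ℝ) * X i j)) *
    ‖Φ.ψ X‖ ^ 2 with hIdef
  have hsrc : (∫ X in cellN N L, (∑ i, 2 * Real.cos (2 * Real.pi / L * ∑ j, (n j : ℝ) * X i j)) *
      ‖Φ.ψ X‖ ^ 2) = 2 * I := by
    rw [hIdef, ← integral_const_mul]
    congr 1; ext X
    rw [← Finset.mul_sum]; ring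
  set t : ℝ := if 0 ≤ I then -(2 * s) else 2 * s with htdef
  have htI : t * I = -(2 * s * |I|) := by
    rw [htdef]; split_ifs with hI
    · rw [abs_of_nonneg hI]; ring
    · rw [abs_of_neg (lt_of_not_ge hI)]; ring
  have ht2 : t ^ 2 = 4 * s ^ 2 := by
    rw [htdef]; split_ifs <;> ring
  have key' := key t Φ hE
  rw [htI, ht2] at key'
  -- denominators
  set a : ℝ := (scatteringLength v).toReal with hadef
  have ha : 0 ≤ a := ENNReal.toReal_nonneg
  set q : ℝ := (2 * Real.pi * ‖(fun j => (n j : ℝ))‖ / L) ^ 2 with hqdef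
  have hnorm : 1 ≤ ‖(fun j => (n j : ℝ))‖ := by
    obtain ⟨i, hi⟩ := Function.ne_iff.1 hn
    have h1 : (1 : ℝ) ≤ |(n i : ℝ)| := by
      have : (1 : ℤ) ≤ |n i| := Int.one_le_abs hi
      exact_mod_cast this
    calc (1 : ℝ) ≤ ‖(n i : ℝ)‖ := by simpa [Real.norm_eq_abs] using h1
      _ ≤ ‖(fun j => (n j : ℝ))‖ := norm_le_pi_norm (fun j => (n j : ℝ)) i
  have hq : 0 < q := by
    rw [hqdef]; apply pow_pos; apply div_pos _ hL
    have := Real.pi_pos; nlinarith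
  have hden : 0 < q + ρ * a := by nlinarith [mul_nonneg hρpos.le ha]
  have hmax : (q + ρ * a) / 2 ≤ max (ρ * a) ((2 * Real.pi / L) ^ 2 * ∑ i, (n i : ℝ) ^ 2) := by
    have h1 : q ≤ (2 * Real.pi / L) ^ 2 * ∑ i, (n i : ℝ) ^ 2 := kinf_sq_le_psq L n
    have h2 := le_max_right (ρ * a) ((2 * Real.pi / L) ^ 2 * ∑ i, (n i : ℝ) ^ 2)
    have h3 := le_max_left (ρ * a) ((2 * Real.pi / L) ^ 2 * ∑ i, (n i : ℝ) ^ 2)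
    linarith
  have hmaxpos : 0 < max (ρ * a) ((2 * Real.pi / L) ^ 2 * ∑ i, (n i : ℝ) ^ 2) := by
    linarith
  -- the real-number chord
  have hreal : (periodicGroundStateEnergy v N L).toReal + 2 * s * |I| ≤
      (periodicEnergy v Φ).toReal + 8 * C * s ^ 2 * N / (q + ρ * a) := by
    have hfrac : C * (4 * s ^ 2) * N / max (ρ * a) ((2 * Real.pi / L) ^ 2 * ∑ i, (n i : ℝ) ^ 2)
        ≤ 8 * C * s ^ 2 * N / (q + ρ * a) := by
      rw [div_le_div_iff₀ hmaxpos hden]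
      have hnum : 0 ≤ C * (4 * s ^ 2) * N := by positivity
      nlinarith [mul_le_mul_of_nonneg_left hmax hnum]
    linarith
  -- back to `ℝ≥0∞`
  have hE0 : periodicGroundStateEnergy v N L ≠ ⊤ :=
    ne_top_of_le_ne_top hE (periodicGroundStateEnergy_le v Φ)
  have hlhs : periodicGroundStateEnergy v N L +
      ENNReal.ofReal (s * |∫ X in cellN N L, (∑ i, 2 * Real.cos (2 * Real.pi / L *
        ∑ j, (n j : ℝ) * X i j)) * ‖Φ.ψ X‖ ^ 2|) =
      ENNReal.ofReal ((periodicGroundStateEnergy v N L).toReal + 2 * s * |I|) := by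
    rw [hsrc, abs_mul, abs_of_pos (by norm_num : (0:ℝ) < 2), ← mul_assoc, mul_comm s 2,
      ENNReal.ofReal_add ENNReal.toReal_nonneg (by positivity), ENNReal.ofReal_toReal hE0]
  rw [hlhs]
  calc ENNReal.ofReal ((periodicGroundStateEnergy v N L).toReal + 2 * s * |I|)
      ≤ ENNReal.ofReal ((periodicEnergy v Φ).toReal + 8 * C * s ^ 2 * N / (q + ρ * a)) :=
        ENNReal.ofReal_le_ofReal hreal
    _ ≤ ENNReal.ofReal ((periodicEnergy v Φ).toReal) +
          ENNReal.ofReal (8 * C * s ^ 2 * N / (q + ρ * a)) := ENNReal.ofReal_add_le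
    _ = periodicEnergy v Φ + ENNReal.ofReal (8 * C * s ^ 2 * N / (q + ρ * a)) := by
        rw [ENNReal.ofReal_toReal hE]

end Summit.AtomisticToContinuum.BoseEinsteinCondensation.Cruxes.DensityResponse.Nesting

/-! ## Bridge 2: the sibling's PHONON BRANCH alone (no kinetic/UV branch) already implies this crux

`PhononBody`/`StaticResponseBoundPhonon` are restated VERBATIM from the sibling skeleton
`Cruxes/StaticResponseBound/Lines/stable-fraction-square-completion.lean` (hyphenated path, not importable)
over the landed vocabulary `psq`, `Ineq` of `Theorems/StaticResponseBound/Negative/Basic.lean`. -/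

namespace Summit.AtomisticToContinuum.BoseEinsteinCondensation.Cruxes.DensityResponse.Nesting

open Literature.MathematicalPhysics.QuantumManyBody.BoseGas
open Summit.AtomisticToContinuum.BoseEinsteinCondensation.Theorems.StaticResponseBound.Negative (psq cosMean Ineq)
open Summit.AtomisticToContinuum.BoseEinsteinCondensation.Theorems.DensityResponse.Negative
  (HoldsWith holdsWith_zero_of_ae)

/-- VERBATIM the sibling skeleton's `PhononBody` (stable-fraction-square-completion, l. 101). -/
def PhononBody (v : ℝ → ℝ≥0∞) (M₀ ρ₀ C : ℝ) : Prop :=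
  ∀ ρ : ℝ, 0 < ρ → ρ < ρ₀ → ∀ N : ℕ, 0 < N → ∀ k : Fin 3 → ℤ, k ≠ 0 →
    psq (sideLength ρ N) k ≤ M₀ ^ 2 * (ρ * (scatteringLength v).toReal) →
    ∀ t : ℝ, ∀ Ψ : PeriodicTrialState N (sideLength ρ N), periodicEnergy v Ψ ≠ ⊤ →
      Ineq v C ρ N k t Ψ

/-- VERBATIM the sibling skeleton's `StaticResponseBoundPhonon` (l. 115): the sibling crux restricted to
the phonon + crossover branch `|p|² ≤ M₀² ρa`, for EVERY `M₀`. -/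
def StaticResponseBoundPhonon : Prop :=
  ∀ v : ℝ → ℝ≥0∞, IsRepulsiveFiniteRange v → ∀ M₀ : ℝ, 0 < M₀ →
    ∃ ρ₀ : ℝ, 0 < ρ₀ ∧ ∃ C : ℝ, 0 < C ∧ PhononBody v M₀ ρ₀ C

/-- `|p|² ≤ 3 (2π‖n‖_∞/L)²`. [folklore] -/
theorem psq_le_three_kinf_sq (L : ℝ) (n : Fin 3 → ℤ) :
    psq L n ≤ 3 * (2 * Real.pi * ‖(fun j => (n j : ℝ))‖ / L) ^ 2 := by
  have hcoord : ∀ i, (n i : ℝ) ^ 2 ≤ ‖(fun j => (n j : ℝ))‖ ^ 2 := fun i => by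
    rw [← sq_abs, ← Real.norm_eq_abs]
    exact pow_le_pow_left₀ (norm_nonneg _) (norm_le_pi_norm (fun j => (n j : ℝ)) i) 2
  have hsum : ∑ i, (n i : ℝ) ^ 2 ≤ 3 * ‖(fun j => (n j : ℝ))‖ ^ 2 := by
    calc ∑ i, (n i : ℝ) ^ 2 ≤ ∑ _i : Fin 3, ‖(fun j => (n j : ℝ))‖ ^ 2 :=
          Finset.sum_le_sum fun i _ => hcoord i
      _ = 3 * ‖(fun j => (n j : ℝ))‖ ^ 2 := by simp
  unfold psq
  calc (2 * Real.pi / L) ^ 2 * ∑ i, (n i : ℝ) ^ 2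
      ≤ (2 * Real.pi / L) ^ 2 * (3 * ‖(fun j => (n j : ℝ))‖ ^ 2) :=
        mul_le_mul_of_nonneg_left hsum (sq_nonneg _)
    _ = 3 * (2 * Real.pi * ‖(fun j => (n j : ℝ))‖ / L) ^ 2 := by ring

/-- **Bridge 2 (window surgery).** The sibling's phonon branch with window parameter `M₀ = M√(3/a)`
covers this crux's whole window `k∞ ≤ M√ρ` when `a(v) > 0`; `a(v) = 0` is the proved free chord
(`holdsWith_zero_of_ae`, landed `Negative/StiffnessSwitch`).  Hence the sibling's IR machinery (stubs A, B,
C1–C3 of `stable-fraction-square-completion`) concludes `DensityResponse` BY NAME with NO kinetic-branch /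
UV-force-wave stub. -/
theorem densityResponse_of_staticResponseBoundPhonon (hP : StaticResponseBoundPhonon) :
    Theses.BECThomsonPrinciple.DensityResponse := by
  intro v hv M hM
  obtain ⟨R₀, hR₀⟩ := hv.2
  by_cases ha : scatteringLength v = 0
  · -- free chord
    have hv0 : ∀ᵐ x : Space, v ‖x‖ = 0 := LSSY2005_zeroScatteringLength_holds v R₀ hv.1 hR₀ ha
    refine ⟨1, 4, one_pos, by norm_num, 0, ?_⟩
    have h := holdsWith_zero_of_ae hv.1 hv0 M 1 0
    rw [ha, ENNReal.toReal_zero]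
    exact h
  -- interacting case: a(v) > 0
  have hapos : 0 < (scatteringLength v).toReal :=
    ENNReal.toReal_pos ha (scatteringLength_ne_top_of_finiteRange hR₀)
  set a : ℝ := (scatteringLength v).toReal with hadef
  set M₀ : ℝ := M * Real.sqrt (3 / a) with hM₀def
  have hM₀ : 0 < M₀ := mul_pos hM (Real.sqrt_pos.2 (div_pos (by norm_num) hapos))
  have hM₀sq : M₀ ^ 2 * a = 3 * M ^ 2 := by
    rw [hM₀def, mul_pow, Real.sq_sqrt (div_pos (by norm_num) hapos).le]
    field_simp
  obtain ⟨ρ₀, hρ₀, C, hC, h⟩ := hP v hv M₀ hM₀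
  refine ⟨ρ₀ / 2, 8 * C, by positivity, by positivity, 1, ?_⟩
  intro N hN L hL hNL n hn hwin s hs Φ
  by_cases hE : periodicEnergy v Φ = ⊤
  · simp [hE]
  set ρ : ℝ := (N : ℝ) / L ^ 3 with hρdef
  have hNpos : (0 : ℝ) < N := Nat.cast_pos.2 hN
  have hL3 : 0 < L ^ 3 := pow_pos hL 3
  have hρpos : 0 < ρ := div_pos hNpos hL3
  have hρlt : ρ < ρ₀ := by
    have : ρ ≤ ρ₀ / 2 := by rw [hρdef, div_le_iff₀ hL3]; exact hNL
    linarith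
  have hL' : sideLength ρ N = L := sideLength_div_pow_three_self hL hN
  -- the window: `k∞² ≤ M² ρ` ⟹ `|p|² ≤ 3M²ρ = M₀² ρ a`
  set q : ℝ := (2 * Real.pi * ‖(fun j => (n j : ℝ))‖ / L) ^ 2 with hqdef
  have hk0 : 0 ≤ 2 * Real.pi * ‖(fun j => (n j : ℝ))‖ / L := by positivity
  have hq_le : q ≤ M ^ 2 * ρ := by
    have h1 : (2 * Real.pi * ‖(fun j => (n j : ℝ))‖ / L) ^ 2 ≤ (M * Real.sqrt (N / L ^ 3)) ^ 2 :=
      pow_le_pow_left₀ hk0 hwin 2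
    rw [mul_pow, Real.sq_sqrt hρpos.le] at h1
    exact h1
  have hwin' : psq (sideLength ρ N) n ≤ M₀ ^ 2 * (ρ * (scatteringLength v).toReal) := by
    rw [hL']
    calc psq L n ≤ 3 * q := psq_le_three_kinf_sq L n
      _ ≤ 3 * (M ^ 2 * ρ) := by nlinarith
      _ = M₀ ^ 2 * (ρ * a) := by
          rw [show M₀ ^ 2 * (ρ * a) = (M₀ ^ 2 * a) * ρ by ring, hM₀sq]; ring
  have key := h ρ hρpos hρlt N hN n hn hwin'
  unfold Ineq cosMean at key
  rw [hL'] at key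
  -- identical plumbing to bridge 1 from here on
  set I : ℝ := ∫ X in cellN N L, (∑ i, Real.cos (2 * Real.pi / L * ∑ j, (n j : ℝ) * X i j)) *
    ‖Φ.ψ X‖ ^ 2 with hIdef
  have hsrc : (∫ X in cellN N L, (∑ i, 2 * Real.cos (2 * Real.pi / L * ∑ j, (n j : ℝ) * X i j)) *
      ‖Φ.ψ X‖ ^ 2) = 2 * I := by
    rw [hIdef, ← integral_const_mul]
    congr 1; ext X
    rw [← Finset.mul_sum]; ring
  set t : ℝ := if 0 ≤ I then -(2 * s) else 2 * s with htdef
  have htI : t * I = -(2 * s * |I|) := by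
    rw [htdef]; split_ifs with hI
    · rw [abs_of_nonneg hI]; ring
    · rw [abs_of_neg (lt_of_not_ge hI)]; ring
  have ht2 : t ^ 2 = 4 * s ^ 2 := by
    rw [htdef]; split_ifs <;> ring
  have key' : (periodicGroundStateEnergy v N L).toReal - C * t ^ 2 * N /
      max (ρ * (scatteringLength v).toReal) (psq L n) ≤ (periodicEnergy v Φ).toReal + t * I :=
    key t Φ hE
  rw [htI, ht2] at key'
  have ha : 0 ≤ a := hapos.le
  have hnorm : 1 ≤ ‖(fun j => (n j : ℝ))‖ := by
    obtain ⟨i, hi⟩ := Function.ne_iff.1 hn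
    have h1 : (1 : ℝ) ≤ |(n i : ℝ)| := by
      have : (1 : ℤ) ≤ |n i| := Int.one_le_abs hi
      exact_mod_cast this
    calc (1 : ℝ) ≤ ‖(n i : ℝ)‖ := by simpa [Real.norm_eq_abs] using h1
      _ ≤ ‖(fun j => (n j : ℝ))‖ := norm_le_pi_norm (fun j => (n j : ℝ)) i
  have hq : 0 < q := by
    rw [hqdef]; apply pow_pos; apply div_pos _ hL
    have := Real.pi_pos; nlinarith
  have hden : 0 < q + ρ * a := by nlinarith [mul_nonneg hρpos.le ha]
  have hmax : (q + ρ * a) / 2 ≤ max (ρ * a) (psq L n) := by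
    have h1 : q ≤ psq L n := kinf_sq_le_psq L n
    have h2 := le_max_right (ρ * a) (psq L n)
    have h3 := le_max_left (ρ * a) (psq L n)
    linarith
  have hmaxpos : 0 < max (ρ * a) (psq L n) := by linarith
  have hreal : (periodicGroundStateEnergy v N L).toReal + 2 * s * |I| ≤
      (periodicEnergy v Φ).toReal + 8 * C * s ^ 2 * N / (q + ρ * a) := by
    have hfrac : C * (4 * s ^ 2) * N / max (ρ * a) (psq L n)
        ≤ 8 * C * s ^ 2 * N / (q + ρ * a) := by
      rw [div_le_div_iff₀ hmaxpos hden]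
      have hnum : 0 ≤ C * (4 * s ^ 2) * N := by positivity
      nlinarith [mul_le_mul_of_nonneg_left hmax hnum]
    have : max (ρ * (scatteringLength v).toReal) (psq L n) = max (ρ * a) (psq L n) := rfl
    rw [this] at key'
    linarith
  have hE0 : periodicGroundStateEnergy v N L ≠ ⊤ :=
    ne_top_of_le_ne_top hE (periodicGroundStateEnergy_le v Φ)
  have hlhs : periodicGroundStateEnergy v N L +
      ENNReal.ofReal (s * |∫ X in cellN N L, (∑ i, 2 * Real.cos (2 * Real.pi / L *
        ∑ j, (n j : ℝ) * X i j)) * ‖Φ.ψ X‖ ^ 2|) =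
      ENNReal.ofReal ((periodicGroundStateEnergy v N L).toReal + 2 * s * |I|) := by
    rw [hsrc, abs_mul, abs_of_pos (by norm_num : (0:ℝ) < 2), ← mul_assoc, mul_comm s 2,
      ENNReal.ofReal_add ENNReal.toReal_nonneg (by positivity), ENNReal.ofReal_toReal hE0]
  rw [hlhs]
  calc ENNReal.ofReal ((periodicGroundStateEnergy v N L).toReal + 2 * s * |I|)
      ≤ ENNReal.ofReal ((periodicEnergy v Φ).toReal + 8 * C * s ^ 2 * N / (q + ρ * a)) :=
        ENNReal.ofReal_le_ofReal hreal
    _ ≤ ENNReal.ofReal ((periodicEnergy v Φ).toReal) +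
          ENNReal.ofReal (8 * C * s ^ 2 * N / (q + ρ * a)) := ENNReal.ofReal_add_le
    _ = periodicEnergy v Φ + ENNReal.ofReal (8 * C * s ^ 2 * N / (q + ρ * a)) := by
        rw [ENNReal.ofReal_toReal hE]

end Summit.AtomisticToContinuum.BoseEinsteinCondensation.Cruxes.DensityResponse.Nesting
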